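import Summits.BirchSwinnertonDyer.BirchSwinnertonDyer.Theorems.ByReductionTypeAtTwoRankOneAtTwoBigImageOddLocalOneDoorBottomPosCebotarev
import Summits.BirchSwinnertonDyer.BirchSwinnertonDyer.Theorems.ByReductionTypeAtTwoRankOneAtTwoBigImageOddLocalOneDoorBottomAssemblyNeg
import Summits.BirchSwinnertonDyer.BirchSwinnertonDyer.Theorems.ByReductionTypeAtTwoRankOneAtTwoBigImageOddLocalOneDoorBottomLeavesRecArch
import Summits.BirchSwinnertonDyer.BirchSwinnertonDyer.Theorems.ByReductionTypeAtTwoRankOneAtTwoBigImageOddLocalOneDoorBottomCrossTransport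
import HarnessLib

/-!
# Route ByReductionTypeAtTwo, crux `RankOneAtTwoBigImageOddLocal` (stmt-BirchSwinnertonDyer-23715), LINE v8.10 `one_door_analytic`:
# U₀⁺ — ASSEMBLY of the first-descent input at `Δ_W > 0`: `FirstDescentInput W Wd` from the first-layer classes at REGULAR primes

Width prover seat `bsd-line-fkl-p2` g11 (2026-08-28), `--supports stmt-BirchSwinnertonDyer-23715` (helper).  THEOREMS ONLY; no
definition, no named fact introduced, no `sorry`; BSD is not proved by any of this.

The `Δ_W > 0` twin of the lead's `nonempty_firstDescentInput_neg` (`…OneDoorBottomAssemblyNeg`), for the registered stub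
`stub_firstDescentLeavesPos : FirstDescentLeavesAtTwoBottomPos` (skeleton v8.10): at a bottom-rung datum with `Δ_W > 0` the record
`FirstDescentInput W Wd` (`…OneDoorFirstDescentDefs`) is BUILT from
* the error place `q₀ = ∞` (`Sum.inr w₀`; Kramer: `[E(ℝ) : 2E(ℝ)] = 2` when `Δ > 0`) — so NO minimality of the door and NO parity of `Dt.c` enters;
* the REGULAR Kolyvagin primes at `2`: `Kol ℓ := jacobiSym W.Δ.num ℓ = -1 ∧ Zhang2014.IsKolyvaginPrime (W.conductorNorm ℤ) W K 2 ℓ ∧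
  1 ≤ Zhang2014.kolyvaginIndex W 2 ℓ` (VERBATIM the output of the supply `…OneDoorBottomPosCebotarev`; proposed body of the lead's `KolPos`), `pl = plOfNat`;
* the Heegner class `y = κ_ℚ(g)` (`exists_heegnerClass_at`, sign-free);
* the leaves: `line₁`/`line₂` = `line_inr_of_Δ_pos` for `W` and for the model `Wd` (`Δ(Wd) = u⁻¹² d_K⁶ Δ_W > 0`); `rec₁`/`rec₂` = `rec_inr_of_card`
  (Poitou–Tate with the error place `∞`) with the counts `#W(ℚ_ℓ)[2] = 2` (`natCard_ker_nsmul_adicCompletion_two_eq_two_of_jacobiSym`) and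
  `#Wd(ℚ_ℓ)[2] = 2` (`natCard_ker_nsmul_two_twist_adicCompletion_eq`) at a regular prime; `ceb₁`/`ceb₂`/`ceb₂'` = `ceb₁_pos_rat` / `ceb₂_pos_rat` /
  `ceb₂'_pos_rat` (cross field transported from the twist equation to the model by `cross_field_of_iso`); habitat `d_K · Δ_W ∉ ℚ^{×2}` is automatic
  (`d_K < 0 < Δ_W`);
* ONE displayed input `hcl`: the first-layer classes at `Δ_W > 0` — `FirstLayerClasses W Wd (Sum.inr w₀) KolPos plOfNat y` (Kolyvagin's `d(ℓ)` at
  `M = 2` for REGULAR `ℓ`, descended to `ℚ` on `W` / `Wd`, Gross 6.1 at every finite `v ≠ ℓ`, Gross 6.2 (2) direct and across = route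
  GenusKolyvaginAtTwo's item 24880 `KolyvaginRelationAtTwo` at `(M, m, l) = (1, 1, ℓ)` — stated for Zhang–Kolyvagin primes, hence for regular ones —
  plus descent).

Main theorem: `nonempty_firstDescentInput_pos`.  Corollary shape for a skeleton v8.11: `FirstDescentLeavesAtTwoBottomPos ⟸ (first-layer classes at
Δ > 0)` + Gross–Zagier, Kolyvagin, modularity, Hoffstein–Luo.

References: [GrossLMS1991] §§3, 6, 9, 10; [McCallumLMS1991] Cor. 3.2, Prop. 4.4, Lemma 5.3; [MazurRubin2010] Lemma 2.2; [Kramer1981] Prop. 6;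
[Kolyvagin1989Izv] §3.
-/

set_option autoImplicit false
-- the Theorems namespace of this sub repeats the summit name by design (D-0017 nested layout)
set_option linter.dupNamespace false

noncomputable section

open scoped Classical

namespace Summit.BirchSwinnertonDyer.BirchSwinnertonDyer.Theorems.RankOneAtTwoOneDoor

open WeierstrassCurve NumberField IsDedekindDomain Literature.NumberTheory.EllipticCurves Literature.NumberTheory.EllipticCurves.ModularForms
  Literature.NumberTheory.GaloisRepresentations Literature.NumberTheory.EllipticCurves.KrizLi2019
  Summit.BirchSwinnertonDyer.Rank1Residual.F1Sign2
  Summit.BirchSwinnertonDyer.Rank1Residual.F1Sign2.TranspositionDoor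
  Summit.BirchSwinnertonDyer.BirchSwinnertonDyer.Theorems.GenusExact
  Summit.BirchSwinnertonDyer.BirchSwinnertonDyer.Theorems.GenusExact.VisiblePairAtTwo

/-! ## The U₀⁺ assembly: `FirstDescentInput W Wd` at a `Δ_W > 0` bottom-rung datum from the first-layer classes at REGULAR primes -/

section Assembly

/-- **`FirstDescentInput W Wd` at a bottom-rung datum with `Δ_W > 0`** — the U₀⁺ twin of `nonempty_firstDescentInput_neg` (MEMO-es §18.11):
error place `q₀ = ∞` (`Sum.inr w∞`; Kramer: `[E(ℝ) : 2E(ℝ)] = 2` at `Δ > 0`), Kolyvagin primes = the REGULAR Kolyvagin primes at `2`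
(`(Δ_min/ℓ) = −1 ∧ Zhang2014.IsKolyvaginPrime N_W W K 2 ℓ ∧ 1 ≤ M(ℓ)` — VERBATIM the output of the supply `ceb₁_pos_rat` / `ceb₂_pos_rat` /
`ceb₂'_pos_rat`), `pl = plOfNat`, `y` from `exists_heegnerClass_at` (sign-free); the leaves `line₁`/`line₂` = `line_inr_of_Δ_pos` (for `W` and for
the model `Wd`, `Δ(Wd) = u⁻¹² d_K⁶ Δ_W > 0`), `rec₁`/`rec₂` = `rec_inr_of_card` with the counts `#W(ℚ_ℓ)[2] = #Wd(ℚ_ℓ)[2] = 2` at a regular prime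
(`natCard_ker_nsmul_adicCompletion_two_eq_two_of_jacobiSym`, `natCard_ker_nsmul_two_twist_adicCompletion_eq`), `ceb₁`/`ceb₂`/`ceb₂'` = the
regular-prime supply (`…OneDoorBottomPosCebotarev`, the cross field transported to the model by `cross_field_of_iso`).  ONE displayed input:
the first-layer classes at `Δ_W > 0` — `FirstLayerClasses W Wd (Sum.inr w∞) KolPos plOfNat y` (Kolyvagin's `d(ℓ)` at `M = 2` for REGULAR `ℓ`,
descended to `ℚ` on `W`/`Wd`, Gross 6.1 off `ℓ` and `∞`, Gross 6.2 (2) direct and across; route GenusKolyvaginAtTwo's item 24880 at `(1, 1, ℓ)`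
read at regular primes).  Modulo Gross–Zagier, Kolyvagin, modularity, Hoffstein–Luo (ranks, through `exists_heegnerClass_at`).  No minimality
of the door and no parity of `Dt.c` is used here. [cite: GrossLMS1991, §10] [cite: McCallumLMS1991, Cor. 3.2, Lemma 5.3] [cite: Kramer1981, Prop. 6]
[cite: Kolyvagin1989Izv, §3] -/
theorem nonempty_firstDescentInput_pos
    (hGZ : ∀ (N : ℕ) [NeZero N] (W : WeierstrassCurve ℚ) (K : Type) [Field K] [NumberField K], gross_zagier N W K)
    (hKo : ∀ (N : ℕ) [NeZero N] (W : WeierstrassCurve ℚ) (K : Type) [Field K] [NumberField K], kolyvagin N W K)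
    (hnf : exists_isNewformOf) (hHL : HoffsteinLuo1997_exists_twist_L_one_ne_zero)
    (W : WeierstrassCurve ℚ) [W.IsElliptic] [W.IsGloballyMinimal] [NeZero (W.conductorNorm ℤ)]
    (hsurj : ∀ n : ℕ, W.HasSurjectiveModNGaloisRep ((2 ^ n : ℕ) : ℤ)) (hT : Odd W.torsionOrder)
    (hr : W.analyticRank = 1)
    (K : Type) [Field K] [NumberField K] (hK : IsImaginaryQuadratic K)
    (hadm : DoorAdmissible W (NumberField.discr K))
    (hLt : (W.quadraticTwist (NumberField.discr K : ℚ)).entireLFunction 1 ≠ 0)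
    (Dt : ModularParametrizationData W (W.conductorNorm ℤ))
    (H : HeegnerDatum (W.conductorNorm ℤ) (NumberField.discr K)) (ι : K →+* ℂ)
    (P : (W.baseChange K).toAffine.Point)
    (hP : WeierstrassCurve.Affine.Point.map ι.toRatAlgHom P = heegnerPointComplex Dt H)
    (Wd : WeierstrassCurve ℚ) [Wd.IsElliptic] (Cd : WeierstrassCurve.VariableChange ℚ)
    (hWd : Cd • W.quadraticTwist (NumberField.discr K : ℚ) = Wd)
    (hm : HasTwoDivisibilityUpToTorsion W K P 0) (hΔ : 0 < W.Δ)
    (hcl : ∀ (w₀ : InfinitePlace ℚ)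
      (hdivK : ∀ Q : geomPoints (W.baseChange K), ∃ R : geomPoints (W.baseChange K), (2 : ℤ) • R = Q)
      (y : galH1Torsion W 2), y ∈ selmerGroup W 2 → resTorsion W K 2 y = kummerMapTorsion (W.baseChange K) 2 hdivK P →
      Nonempty (FirstLayerClasses W Wd (Sum.inr w₀)
        (fun ℓ => jacobiSym W.Δ.num ℓ = -1 ∧ Zhang2014.IsKolyvaginPrime (W.conductorNorm ℤ) W K 2 ℓ ∧
          1 ≤ Zhang2014.kolyvaginIndex W 2 ℓ) plOfNat y)) :
    Nonempty (FirstDescentInput W Wd) := by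
  haveI hEK : (W.baseChange K).IsElliptic := isElliptic_baseChange' W K
  have h2K : Module.finrank ℚ K = 2 := hK.1
  have hD0 : (NumberField.discr K : ℚ) ≠ 0 := by exact_mod_cast NumberField.discr_ne_zero K
  haveI : (W.quadraticTwist ((NumberField.discr K : ℤ) : ℚ)).IsElliptic := W.isElliptic_quadraticTwist hD0
  have hsurj2 : W.HasSurjectiveModNGaloisRep 2 := by simpa using hsurj 1
  -- habitat bookkeeping at `Δ_W > 0`
  have hdneg : NumberField.discr K < 0 := hadm.1
  have hdQ : ((NumberField.discr K : ℤ) : ℚ) < 0 := by exact_mod_cast hdneg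
  have hns : ¬ IsSquare ((NumberField.discr K : ℚ) * W.Δ) := by
    rintro ⟨r, hr⟩
    nlinarith [mul_self_nonneg r, mul_neg_of_neg_of_pos hdQ hΔ]
  have hΔ' : 0 < (W.quadraticTwist ((NumberField.discr K : ℤ) : ℚ)).Δ := by
    rw [quadraticTwist_Δ]
    exact mul_pos (Even.pow_pos ⟨3, by norm_num⟩ hD0) hΔ
  have hΔd : 0 < Wd.Δ := by
    rw [← hWd, variableChange_Δ]
    exact mul_pos (Even.pow_pos ⟨6, by norm_num⟩ (Units.ne_zero _)) hΔ'
  obtain ⟨θ, hθ, hθsq⟩ := Literature.NumberTheory.EllipticCurves.exists_sq_eq_discr_not_mem_range K h2K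
  have hcθ : θ ^ 2 = algebraMap ℚ K ((NumberField.discr K : ℤ) : ℚ) := by exact_mod_cast hθsq
  obtain ⟨w₀⟩ := (inferInstance : Nonempty (InfinitePlace ℚ))
  -- `2`-divisibility of geometric points
  have hdivQ : ∀ Q : geomPoints W, ∃ R : geomPoints W, (2 : ℤ) • R = Q :=
    fun Q => W.zsmul_geomPoints_surjective_holds two_ne_zero Q
  have hdivK : ∀ Q : geomPoints (W.baseChange K), ∃ R : geomPoints (W.baseChange K), (2 : ℤ) • R = Q :=
    fun Q => (W.baseChange K).zsmul_geomPoints_surjective_holds two_ne_zero Q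
  -- the Heegner class `y`
  obtain ⟨y, hymem, hy0, hyres⟩ := exists_heegnerClass_at hGZ hKo hnf hHL W hT hr K hK hadm hLt Dt H ι P hP hm hdivQ hdivK
  -- the first-layer classes (displayed input)
  obtain ⟨cl⟩ := hcl w₀ hdivK y hymem hyres
  -- bookkeeping at a regular Kolyvagin prime
  have hnum : W.Δ.num = minimalDiscriminantInt W := by rw [← cast_minimalDiscriminantInt W, Rat.num_intCast]
  have hKolFacts : ∀ ℓ, (jacobiSym W.Δ.num ℓ = -1 ∧ Zhang2014.IsKolyvaginPrime (W.conductorNorm ℤ) W K 2 ℓ ∧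
      1 ≤ Zhang2014.kolyvaginIndex W 2 ℓ) → ∃ hℓ : ℓ.Prime, ℓ ≠ 2 ∧
      (haveI : Fact ℓ.Prime := ⟨hℓ⟩; W.HasGoodReductionAtPrime ℓ) ∧ ¬ (ℓ : ℤ) ∣ W.Δ.num ∧ jacobiSym W.Δ.num ℓ = -1 ∧
      plOfNat ℓ = Sum.inl (Rat.HeightOneSpectrum.primesEquiv.symm ⟨ℓ, hℓ⟩) ∧
      (ℓ : 𝓞 ℚ) ∈ (Rat.HeightOneSpectrum.primesEquiv.symm ⟨ℓ, hℓ⟩ : HeightOneSpectrum (𝓞 ℚ)).asIdeal := by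
    rintro ℓ ⟨hjac, hKol, -⟩
    have hℓ : ℓ.Prime := hKol.1
    haveI : Fact ℓ.Prime := ⟨hℓ⟩
    have hgood : W.HasGoodReductionAtPrime ℓ := hasGoodReductionAtPrime_of_not_dvd_conductorNorm W hKol.2.1
    refine ⟨hℓ, hKol.2.2.2.1, hgood, ?_, hjac, plOfNat_of_prime hℓ, natCast_mem_primesEquiv_symm hℓ⟩
    rw [hnum]; exact not_dvd_minimalDiscriminantInt_of_hasGoodReductionAtPrime' W ℓ hgood
  refine ⟨⟨Sum.inr w₀, fun ℓ => jacobiSym W.Δ.num ℓ = -1 ∧ Zhang2014.IsKolyvaginPrime (W.conductorNorm ℤ) W K 2 ℓ ∧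
      1 ≤ Zhang2014.kolyvaginIndex W 2 ℓ, plOfNat, y, hymem, hy0, cl.c₁, cl.c₂, cl.c₁_loc, cl.c₁_loc_iff, cl.c₂_loc, cl.c₂_loc_iff,
    ?_, ?_, ?_, ?_, ?_, ?_, ?_⟩⟩
  · -- rec₁ (error place `∞`, count `#W(ℚ_ℓ)[2] = 2`)
    intro ℓ hKol d hd hdv s hs hsv
    obtain ⟨hℓ, hℓ2, hgood, hℓΔ, hjac, hpl, hℓv⟩ := hKolFacts ℓ hKol
    haveI : Fact ℓ.Prime := ⟨hℓ⟩
    rw [hpl] at hd hdv hsv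
    exact rec_inr_of_card W hℓ2 hℓv (natCard_ker_nsmul_adicCompletion_two_eq_two_of_jacobiSym W hℓ2 hgood hℓΔ hjac hℓv) w₀ d hd hdv
      s hs hsv
  · -- rec₂ (the same count for the model `Wd` of the twist)
    intro ℓ hKol d hd hdv s hs hsv
    obtain ⟨hℓ, hℓ2, hgood, hℓΔ, hjac, hpl, hℓv⟩ := hKolFacts ℓ hKol
    haveI : Fact ℓ.Prime := ⟨hℓ⟩
    rw [hpl] at hd hdv hsv
    refine rec_inr_of_card Wd hℓ2 hℓv ?_ w₀ d hd hdv s hs hsv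
    rw [natCard_ker_nsmul_two_twist_adicCompletion_eq W hD0 hWd]
    exact natCard_ker_nsmul_adicCompletion_two_eq_two_of_jacobiSym W hℓ2 hgood hℓΔ hjac hℓv
  · -- ceb₁
    obtain ⟨ℓ, -, hjac, hKol, hidx, hloc⟩ :=
      ceb₁_pos_rat (W.conductorNorm ℤ) W dvd_rfl hΔ hK hns hsurj2 hθ hcθ hΔ' y hy0 0
    refine ⟨ℓ, ⟨hjac, hKol, hidx⟩, ?_⟩
    rw [plOfNat_of_prime hKol.1]
    exact hloc _ (natCast_mem_primesEquiv_symm hKol.1)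
  · -- ceb₂
    intro s hs0 hsy _hs
    obtain ⟨ℓ, -, hjac, hKol, hidx, hloc⟩ :=
      ceb₂_pos_rat (W.conductorNorm ℤ) W dvd_rfl hΔ hK hns hsurj2 hθ hcθ hΔ' s y hs0 hy0 hsy 0
    refine ⟨ℓ, ⟨hjac, hKol, hidx⟩, ?_⟩
    rw [plOfNat_of_prime hKol.1]
    exact hloc _ (natCast_mem_primesEquiv_symm hKol.1)
  · -- ceb₂' (cross pair, transported from the twist equation to the model `Wd`)
    intro s hs0 hs
    refine cross_field_of_iso hWd _ plOfNat (Sum.inr w₀) y (fun s' hs0' _ => ?_) s hs0 hs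
    obtain ⟨ℓ, -, hjac, hKol, hidx, hloc⟩ :=
      ceb₂'_pos_rat (W.conductorNorm ℤ) W dvd_rfl hΔ hK hns hsurj2 hθ hcθ hΔ' s' y hs0' hy0 0
    refine ⟨ℓ, ⟨hjac, hKol, hidx⟩, ?_, ?_⟩
    · rw [plOfNat_of_prime hKol.1]
      exact (hloc _ (natCast_mem_primesEquiv_symm hKol.1)).1
    · rw [plOfNat_of_prime hKol.1]
      exact (hloc _ (natCast_mem_primesEquiv_symm hKol.1)).2
  · -- line₁
    exact line_inr_of_Δ_pos W hΔ w₀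
  · -- line₂
    exact line_inr_of_Δ_pos Wd hΔd w₀

/-- **`FirstDescentLeavesAtTwoBottomPos` ⟸ the first-layer classes at `Δ_W > 0` (REGULAR primes)**, modulo Gross–Zagier, Kolyvagin, modularity,
Hoffstein–Luo — the U₀⁺ twin of `firstDescentLeavesAtTwoBottomNeg_of_classes`.  The hypothesis `hcl` is the PROPOSED body of the lead's
`FirstLayerClassesAtTwoBottomPos` (binders of `FirstDescentLeavesAtTwoBottomPos` VERBATIM, then `0 < W.Δ`, an infinite place `w₀`, a `2`-divisibility
datum for `E_K(K̄)` and a class `y ∈ Sel₂(W/ℚ)` with `res_K y = κ_K(P)`; conclusion `Nonempty (FirstLayerClasses W Wd (Sum.inr w₀) KolPos plOfNat y)`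
with `KolPos ℓ := jacobiSym W.Δ.num ℓ = -1 ∧ Zhang2014.IsKolyvaginPrime (W.conductorNorm ℤ) W K 2 ℓ ∧ 1 ≤ Zhang2014.kolyvaginIndex W 2 ℓ`): so a skeleton
v8.11 may carry `stub_firstLayerClassesPos` and derive `stub_firstDescentLeavesPos` through this theorem. [cite: GrossLMS1991, §10] [cite: Kramer1981, Prop. 6]
[cite: Kolyvagin1989Izv, §3] -/
theorem firstDescentLeavesAtTwoBottomPos_of_classes
    (hGZ : ∀ (N : ℕ) [NeZero N] (W : WeierstrassCurve ℚ) (K : Type) [Field K] [NumberField K], gross_zagier N W K)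
    (hKo : ∀ (N : ℕ) [NeZero N] (W : WeierstrassCurve ℚ) (K : Type) [Field K] [NumberField K], kolyvagin N W K)
    (hnf : exists_isNewformOf) (hHL : HoffsteinLuo1997_exists_twist_L_one_ne_zero)
    (hcl : ∀ (W : WeierstrassCurve ℚ) [W.IsElliptic] [W.IsGloballyMinimal] [NeZero (W.conductorNorm ℤ)],
      ¬ W.HasCM → (∀ n : ℕ, W.HasSurjectiveModNGaloisRep ((2 ^ n : ℕ) : ℤ)) → Odd W.torsionOrder → Odd W.tamagawaProduct →
      W.analyticRank = 1 →
      ∀ (K : Type) [Field K] [NumberField K], IsImaginaryQuadratic K →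
        DoorAdmissible W (NumberField.discr K) →
        (W.quadraticTwist (NumberField.discr K : ℚ)).entireLFunction 1 ≠ 0 →
        ∀ (Dt : ModularParametrizationData W (W.conductorNorm ℤ))
          (H : HeegnerDatum (W.conductorNorm ℤ) (NumberField.discr K)) (ι : K →+* ℂ)
          (P : (W.baseChange K).toAffine.Point),
          WeierstrassCurve.Affine.Point.map ι.toRatAlgHom P = heegnerPointComplex Dt H →
          ∀ (Wd : WeierstrassCurve ℚ) [Wd.IsElliptic] [Wd.IsGloballyMinimal] (Cd : WeierstrassCurve.VariableChange ℚ),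
            Cd • W.quadraticTwist (NumberField.discr K : ℚ) = Wd →
            transpCount W (NumberField.discr K) + 2 * identCount W (NumberField.discr K) = (if W.Δ < 0 then 1 else 0) → Odd Dt.c →
            HasTwoDivisibilityUpToTorsion W K P 0 →
            0 < W.Δ →
            ∀ (w₀ : InfinitePlace ℚ)
              (hdivK : ∀ Q : geomPoints (W.baseChange K), ∃ R : geomPoints (W.baseChange K), (2 : ℤ) • R = Q)
              (y : galH1Torsion W 2), y ∈ selmerGroup W 2 →
              resTorsion W K 2 y = kummerMapTorsion (W.baseChange K) 2 hdivK P →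
                Nonempty (FirstLayerClasses W Wd (Sum.inr w₀)
                  (fun ℓ => jacobiSym W.Δ.num ℓ = -1 ∧ Zhang2014.IsKolyvaginPrime (W.conductorNorm ℤ) W K 2 ℓ ∧
                    1 ≤ Zhang2014.kolyvaginIndex W 2 ℓ) plOfNat y)) :
    FirstDescentLeavesAtTwoBottomPos := by
  intro W _ _ _ hCM hsurj hT hc hr K _ _ hK hadm hLt Dt H ι P hP Wd _ _ Cd hWd hmin hodd hm hΔ
  exact nonempty_firstDescentInput_pos hGZ hKo hnf hHL W hsurj hT hr K hK hadm hLt Dt H ι P hP Wd Cd hWd hm hΔ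
    (fun w₀ hdivK y hymem hyres =>
      hcl W hCM hsurj hT hc hr K hK hadm hLt Dt H ι P hP Wd Cd hWd hmin hodd hm hΔ w₀ hdivK y hymem hyres)

end Assembly

end Summit.BirchSwinnertonDyer.BirchSwinnertonDyer.Theorems.RankOneAtTwoOneDoor

end
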